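import Summits.MatrixMultiplication.MatrixMultiplication.Theorems.AbelianSTPPCensusShapeCertVQSearchPS
import Summits.MatrixMultiplication.MatrixMultiplication.Theorems.AbelianSTPPCensusShapeCertVQEvalS427a

/-!
# Abelian STPP census — the vQ certificate `checkQS` at order 427, assembled from its path segments

Cell mm-stpp, rung F-M1; successor kernel item VQ-CERT in support of the closed crux item stmt-MatrixMultiplication-19191; seat
mm-stpp-vp-p2 (gen 2); support file (no definitions; the only kernel evaluations are block-index bounds `i < #blocks`).  Folds the
kernel-evaluated path segments of `…AbelianSTPPCensusShapeCertVQEvalS427a…` into `ShapeCertVQ.checkQS 427 = true` with `pathOutS_append` /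
`pathInS_append` / `pathOut_single_of_in` / `pathIn_single_of_child` / `pathOK_of_out` / `checkQS_of_pathOK_nil` (`…ShapeCertVQSearchPS`).
WHAT THIS IS NOT: a Boolean fact; no statement about STPP families or `ω` by itself.
-/

set_option linter.dupNamespace false -- `MatrixMultiplication.MatrixMultiplication` (summit = problem, D-0017)
set_option autoImplicit false

namespace Summit.MatrixMultiplication.MatrixMultiplication.Theorems.ShapeCertVQ

/-- the one-block outer segment at node `[]`, block `5`, from its inner segments -/
theorem pso_427_r_o5_1 : pathOutS 427 [] 5 1 = true :=
  pathOut_single_of_in (pathInS_append psi_427_r_b5_0_15 psi_427_r_b5_15_9999) (by decide +kernel) (by norm_num)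

/-- the node `[]` of order `427` is accepted by the search -/
theorem pok_427_r : PathOKS 427 [] :=
  pathOK_of_out (pathOutS_append (pathOutS_append pso_427_r_o0_5 pso_427_r_o5_1) pso_427_r_o6_9999) (lt_of_le_of_lt (pathNodeS_blocks_le 427 []) (by norm_num)) (by norm_num)

/-- **vQ certificate check `checkQS` at order `427`**, assembled from its path segments -/
theorem checkQS_427 : checkQS 427 = true := checkQS_of_pathOK_nil pok_427_r

end Summit.MatrixMultiplication.MatrixMultiplication.Theorems.ShapeCertVQ
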